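import Literature.MathematicalPhysics.QuantumFieldTheory.BalabanImbrieJaffe1984to88.BIJ88PairActivity309

/-!
# `BalabanImbrieJaffe1984to88.BIJ88Ineq5144TwoCube` — T. Bałaban, J. Imbrie, A. Jaffe, *Effective action and cluster properties of the abelian
Higgs model*, Commun. Math. Phys. **114** (1988) 257–315 [BalabanImbrieJaffe1988], Sect. 5.14, (5.14.4) p. 309 [PDF 53]: **(5.14.4) ON THE
TWO-CUBE POLYMERS `|X_β| = 2` OF THE §5.13 MODEL, FOR ANY COUPLING `Δ ≻ 0`** — the first multi-cube activities for COUPLED data (for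
block-diagonal `Δ` they vanish, `BIJ88Eq5145HeadMultiCubeSlots.actIn_eq_zero_of_two_le`, p36 gen 16); companion of `BIJ88Ineq5144OneCube`
(p36 gen 15: `|X_β| = 1`) and `BIJ88SlotFieldGaussBounds` (p36 gen 16: the Gaussian tails from structural data).

statement-level skeleton of published theorems with citation tags; proofs where landed; nothing here is a claim about the Yang–Mills mass gap

PDF held: `paper:balaban1988-cmp114-bij-abelian-higgs-effective-action` (journal page = PDF page + 256); pp. 307, 309 = PDF 51, 53 rendered (x2)
and read as images this generation.  p. 309, verbatim: *"Let us drop the prime, and prove that |g₃(H_β, X_β)| ≦ (e^β(L^kε/ε₀)^{1/4−α})^{[|H_β| +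
β′|X_β∖H_β|]}. (5.14.4) We use X_β∖H_β to denote the set of cubes with no (d/dt)_{γ_j} factors, j ∈ H_β. The proof of this estimate is similar to
the one for g₂. We mention only the new features. Each factor V^{(k)}(Y) in Π_{j∈H_β} (d/dt)_{γ_j} produces a factor e^β(L^kε/ε₀)^{1/4−α} in the final
estimate. … The factors e^{−tV^{(k)}(Y)} − 1 can be bounded as before, because the coefficient t in front of V^{(k)}(Y) plus a small power of e_k
easily beat the bounds A^{(k)}, φ^{(k)} ≦ cp(e_k). Each t-derivative of a χ-factor in χ′_{Λ₁₂^{(k)},t} gives at least a factor e^β(L^kε/ε₀)^{1/4−α}."*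
p. 307, verbatim: *"Each time some □_i's are joined, we have s-derivatives, which produce functional derivatives, chains of covariances C_{ω(α)},
and factors ℱ = O(e^{−cr(e_k)}). … These derivatives are supported at |A^{(k)″}| ≧ cp(e_k) or |φ^{(k)″}| ≧ cp(e_k) (here we use the fact that the
translation vanishes). … and from extremely small factors when a χ′-factor is replaced by 1."*

WHAT IS PROVED (unit `lit-balaban-p36`, generation 17 of the Phase-2 proof seat p36; SKELETON row **C2.Eq5.14.3-5.14.4** member cell of
`HOME/lit-balaban-r16/ROWS-C2-part2.md`, owner r16; row **C2.Eq5.14.5** member).  Data: the §5.13 model of this lineage (`BIJ88W6PrimeVsupp.actIn`: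
sites `α`, cubes `blk`, precision `Δ ≻ 0` with ANY inter-cube coupling, source `ℱ`, χ-slots with slot fields `Φ_b` and thresholds `c_b p(te_k)`,
interaction slots with terms `V(Y)`; the located data of a region `X` at a corner `Λ`, time `t`, assignment `γ` of derivative labels).
INPUTS BY NAME from the companion `BIJ88PairActivity309` (same seat and generation): `actIn_pair_eq` — the prime-dropped activity of `(H, {i,j})`
is `[{i,j} connected]·(∫Π dlaw_{1_{{i,j}}} − ∫Π dlaw_{1_∅})`, `Π` = the product over the slots located in `□_i ∪ □_j` of their slot factors differentiated
as `H` prescribes; `tail_slotField_regionLaw_of_struct` — the Gaussian tail of every slot field under both laws from `(m, Λ, F)`; `src_pair_le`.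
* §3 **`ineq5144_locAct_pair_of_struct`** — (5.14.4), LOCATED READING, ON EVERY TWO-CUBE POLYMER, conclusion verbatim `|locAct (cubeIn ∘ γ)
  (actIn … t γ) H X₂| ≤ θ^{|H| + β′|X₂ ∖ loc H|}` for every corner, region, `t ∈ (0,1]`, `|L| ≤ n₀`, assignment.  Proof: (H = ∅) TWICE the p. 307
  vacuum mechanism on the `≤ 2G` slots of the pair (gen 15's `abs_integral_prod_slotFactor_sub_one_le_rpow` under the coupled AND the decoupled law);
  (H ≠ ∅, located) TWICE the p. 309 derivative factors (gen 15's `abs_integral_prod_iteratedDeriv_slotFactor_le_pow` on the joint slot family).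
  HYPOTHESES: those of `BIJ88SlotFieldGaussBounds.ineq5144_locAct_singleton_of_struct` and the TWO-CUBE REGIME (pair tail constant `A₂ = 4e^{F²/m}`,
  `κ = m/(8Λ²)`, weight `e^{2GK₁}`): `n₀ + 1 ≤ κ(81/100)c₀²|log e_k⁻¹|^{2p−1}` · `Ĉ^{n₀}A₂e^{2GK₁}e_k ≤ 1` · `e^{2GK₁}·2G·A₂·e_k + (e^{2GK₁} − 1) ≤
  θ^{2β′}/2` (print's vacuum inequality, for the pair) · `e_k ≤ θ^{1+β′}/2` · `K_Y e^{2GK₁} ≤ θ^{1+β′}/2`.  **HONEST ADJUSTMENT (declared): the last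
  two replace print's per-derivative factor `θ` by `θ^{1+β′}/2`** (p. 310: *"We allow adjustments in β, α, β′, keeping them small"*) — for a pair
  whose labels all sit in ONE cube this is where the undecorated cube's `θ^{β′}` comes from here; print takes it from the `s`-derivative JOINING the
  cubes (p. 307 above; the (5.13.3) trains of p13's `BIJ88WalkForm5133`), which is NOT reproduced: NO smallness is extracted from the inter-cube
  coupling in this file.  `e_k ≤ θ^{1+β′}/2` is harmless in print's regime (`e_k = e(L^kε)^{1/2}` vs `θ = e^β(L^kε/ε₀)^{1/4−α}`); `K_Y e^{2GK₁} ≤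
  θ^{1+β′}/2` strengthens p. 303's `|V^{(k)}(Y)| ≤ θ` by `θ^{β′}/2`.
HONEST SCOPE: model-level member theorems for r16's typed leaf `BIJ88Sect5StatementsPart2.Ineq5144` (head typed, owner's call); the decay in `|X_β|`
(print: *"similar to the one for g₂"*, §5.13's cluster expansion with [3] Sect. 14, [9], [10]) is NOT proved — after gens 15–17 the open part of the
leaf is `|X_β| ≥ 3` for coupled `Δ` plus the join mechanism replacing the adjustment; print's sizes of `m, Λ, F` are NOT derived.
* §4 **`two_le_of_three_le`** — the multi-cube leaf hypothesis `h5144two` of the C2.Eq5.14.5 head of record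
  (`BIJ88Eq5145HeadMultiCube.eq5145_zG_mod_W6v_of_ineq5144_two_le`: (5.14.4) located on the polymers with `≥ 2` cubes) FOLLOWS, in the regime of §3,
  from its part on the polymers with `≥ 3` cubes.
0 `sorry`, 0 definitions, 0 `Prop` facts (D-0026); imports `BIJ88PairActivity309` (p36 g17) only; modifies nothing.
NOT summit progress; NOT continuum; NOT Clay.  Cell `lit-balaban` Phase 2, seat p36 gen 17 (owner r16, referee ref-5).
-/

noncomputable section

open Finset MeasureTheory ProbabilityTheory Matrix
open Literature.MathematicalPhysics.QuantumFieldTheory.BalabanImbrieJaffe1984to88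
open BIJ88Sect2Statements (pLog)
open BIJ88Sect5Statements (CutoffProfile cutoff)
open BIJ88SlotMoments308 (slotFactor)
open BIJ88DirichletForms305 (interpForm interpForm_apply quadForm_interpForm_ge interpForm_posDef)
open BIJ88Clusters5134 (cornerSum act)
open BIJ88PolymerRep5134 (g1 g1_of_two_le IsConn corner corner_apply)
open BIJ88PolymerRep5134Gauss (ext obs prec src zG)
open BIJ88Expansion5143 (g3 prime prime_of_not)
open BIJ88Expansion5143Gauss (fD)
open BIJ88SlotMomentsGauss308 (uD fieldLaw measurable_ext)
open BIJ88Eq5145CornerModel (slotB slotY mem_slotB mem_slotY regionLaw zG_eq_integral_regionLaw isProbabilityMeasure_regionLaw)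
open BIJ88Eq5145CornerUrsell (cubeIn cubeIn_mem)
open BIJ88W6PrimeVsupp (actIn)
open BIJ88W6PrimeVsuppBound (card_filter_cubeIn_le)
open BIJ88Ineq5144Located (locAct locAct_of_loc locAct_of_not_loc)
open BIJ88OneCubeVertexFactors309 (abs_integral_prod_iteratedDeriv_slotFactor_le_pow abs_integral_prod_slotFactor_sub_one_le_rpow)
open BIJ88SlotFieldGaussBounds (tail_slotField_fieldLaw_of_struct tail_constants_eq sum_eq_sum_site)
open BIJ88PairActivity309 (actIn_pair_eq tail_slotField_regionLaw_of_struct src_pair_le interp_corner_posDef)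

namespace Literature.MathematicalPhysics.QuantumFieldTheory.BalabanImbrieJaffe1984to88.BIJ88Ineq5144TwoCube

/-! ## §3 (5.14.4) on the two-cube polymers, located reading, for any coupling `Δ ≻ 0` -/

section TwoCube

variable {α I : Type} [Fintype α] [DecidableEq α] [Fintype I] [DecidableEq I]
  (blk : α → I) (Δ : Matrix α α ℝ) (ℱ : α → ℝ)
variable (adj : I → I → Prop) [DecidableRel adj]
variable (χ : CutoffProfile) {ι υ : Type*} [DecidableEq ι] [DecidableEq υ]
variable {p ek : ℝ} {B : Finset ι} {Φ : ι → (α → ℝ) → ℝ} {c : ι → ℝ} {Ys : Finset υ} {V : υ → (α → ℝ) → ℝ}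
variable (cube : ↥B ⊕ ↥Ys → I)

/-- arithmetic of the adjusted derivative factor: `2(θ^{1+β′}/2)ⁿ ≤ θ^{n + β′k}` for `1 ≤ n`, `k ≤ n`, `0 < θ ≤ 1`, `0 ≤ β′`.
[cite: BalabanImbrieJaffe1988, (5.14.4) p.309] -/
theorem two_mul_half_rpow_pow_le {θ β' : ℝ} (hθ0 : 0 < θ) (hθ1 : θ ≤ 1) (hβ : 0 ≤ β') {n k : ℕ} (hn : 1 ≤ n) (hk : k ≤ n) :
    2 * (θ ^ (1 + β') / 2) ^ n ≤ θ ^ ((n : ℝ) + β' * (k : ℝ)) := by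
  have hθp : 0 < θ ^ (1 + β') := Real.rpow_pos_of_pos hθ0 _
  have h2n : (2 : ℝ) ≤ 2 ^ n := by
    calc (2 : ℝ) = 2 ^ 1 := (pow_one _).symm
      _ ≤ 2 ^ n := pow_le_pow_right₀ (by norm_num) hn
  have hkn : (k : ℝ) ≤ n := by exact_mod_cast hk
  calc 2 * (θ ^ (1 + β') / 2) ^ n = (2 / 2 ^ n) * (θ ^ (1 + β')) ^ n := by rw [div_pow]; ring
    _ ≤ 1 * (θ ^ (1 + β')) ^ n := by
        gcongr
        rw [div_le_one (by positivity)]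
        exact h2n
    _ = θ ^ ((1 + β') * n) := by rw [one_mul, ← Real.rpow_natCast, ← Real.rpow_mul hθ0.le]
    _ ≤ θ ^ ((n : ℝ) + β' * (k : ℝ)) := Real.rpow_le_rpow_of_exponent_ge hθ0 hθ1 (by nlinarith)

/-- **(5.14.4) ON THE TWO-CUBE POLYMERS, IN THE MODEL, LOCATED READING, FOR ANY COUPLING `Δ ≻ 0`** (p. 309: *"|g₃(H_β, X_β)| ≦
(e^β(L^kε/ε₀)^{1/4−α})^{[|H_β| + β′|X_β∖H_β|]} (5.14.4) … Each factor V^{(k)}(Y) in Π (d/dt)_{γ_j} produces a factor e^β(L^kε/ε₀)^{1/4−α} …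
The factors e^{−tV^{(k)}(Y)} − 1 can be bounded as before … Each t-derivative of a χ-factor in χ′_{Λ₁₂^{(k)},t} gives at least a factor
e^β(L^kε/ε₀)^{1/4−α}"*; p. 307: *"extremely small factors when a χ′-factor is replaced by 1"*).  Data and structural hypotheses of
`BIJ88SlotFieldGaussBounds.ineq5144_locAct_singleton_of_struct` (all-orders constant `Ĉ` for orders `≤ n₀`; `Δ ≥ m·1`; slot fields linear or moduli
with `|ℓ_j φ| ≤ Λ‖φ‖₂`; `‖ℱ|_□‖₂ ≤ F`; `c_b ≥ c₀ > 0`; measurable `|V(Y)| ≤ K_Y ≤ K₁`; `≤ G` slots per cube; `0 < e_k ≤ e⁻¹`; `0 < θ ≤ 1`,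
`0 ≤ β′`) in the TWO-CUBE REGIME (pair tail constant `A₂ = 4e^{F²/m}`, `κ = m/(8Λ²)`, interaction weight `e^{2GK₁}`):
`n₀ + 1 ≤ κ(81/100)c₀²|log e_k⁻¹|^{2p−1}` · `Ĉ^{n₀}A₂e^{2GK₁}e_k ≤ 1` · `e^{2GK₁}·2G·A₂·e_k + (e^{2GK₁} − 1) ≤ θ^{2β′}/2` ·
`e_k ≤ θ^{1+β′}/2` · `K_Y e^{2GK₁} ≤ θ^{1+β′}/2` (the last two = print's per-derivative factor `θ` ADJUSTED to `θ^{1+β′}/2`, p. 310 *"We allow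
adjustments in β, α, β′"*; see the module docstring: the join mechanism of p. 307 is NOT reproduced).  CONCLUSION, for every corner `Λ`, region `X`,
`t ∈ (0,1]`, `|L| ≤ n₀`, assignment `γ`, label set `H` and two-cube polymer `X₂`: `|locAct (cubeIn ∘ γ) (actIn … t γ) H X₂| ≤ θ^{|H| + β′|X₂ ∖ loc H|}`
(`BIJ88Sect5StatementsPart2.Ineq5144` with `nH = card`, `nRest H X = |X ∖ loc H|`, restricted to `|X| = 2`).  Proof: `actIn_pair_eq`; for `H = ∅`
twice gen 15's vacuum estimate (`|∫Π dP − 1| ≤ θ^{2β′}/2` under the coupled and the decoupled law); for `H ≠ ∅` twice gen 15's derivative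
estimate (`|∫Π dP| ≤ (θ^{1+β′}/2)^{|H|}`) and `two_mul_half_rpow_pow_le`. [cite: BalabanImbrieJaffe1988, (5.14.4) p.309; p.307 (Sect. 5.13)] -/
theorem ineq5144_locAct_pair_of_struct [Fintype ι] [Fintype υ] (hp : 1 / 2 < p) {n₀ : ℕ} {C : ℝ} (hC1 : 1 ≤ C)
    (hC : ∀ i, i ≤ n₀ → ∀ (A : ℝ) ⦃q e t : ℝ⦄, q ≠ 0 → 0 < e → 0 < t → t * e ≤ Real.exp (-1) →
      |iteratedDeriv i (fun s => cutoff χ (q * pLog p (s * e)) A) t| ≤ C * t ^ (-(i : ℤ)))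
    (hΔ : Δ.PosDef) {m : ℝ} (hm : 0 < m) (hΔm : ∀ φ : α → ℝ, m * (φ ⬝ᵥ φ) ≤ φ ⬝ᵥ (Δ *ᵥ φ))
    (hχ : ∀ x, 0 ≤ χ.χ₁ x) {c₀ : ℝ} (hc₀ : 0 < c₀) (hcb : ∀ b ∈ B, c₀ ≤ c b) {Λ : ℝ} (hΛ : 0 < Λ)
    (hmod : ∀ b ∈ B, ∃ ℓ₁ ℓ₂ : (α → ℝ) → ℝ, IsLinearMap ℝ ℓ₁ ∧ IsLinearMap ℝ ℓ₂ ∧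
      ((∀ φ, Φ b φ = ℓ₁ φ) ∨ (∀ φ, Φ b φ = Real.sqrt (ℓ₁ φ ^ 2 + ℓ₂ φ ^ 2))) ∧
      (∀ φ, |ℓ₁ φ| ≤ Λ * Real.sqrt (φ ⬝ᵥ φ)) ∧ (∀ φ, |ℓ₂ φ| ≤ Λ * Real.sqrt (φ ⬝ᵥ φ)))
    {F : ℝ} (hF0 : 0 ≤ F) (hF : ∀ i : I, src blk ℱ {i} ⬝ᵥ src blk ℱ {i} ≤ F ^ 2)
    (hV : ∀ Y ∈ Ys, Measurable (V Y)) {KY : υ → ℝ} (hK : ∀ Y ∈ Ys, ∀ φ, |V Y φ| ≤ KY Y)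
    {K₁ : ℝ} (hK₁0 : 0 ≤ K₁) (hK₁ : ∀ Y ∈ Ys, KY Y ≤ K₁) {G : ℕ} (hG : ∀ i, (univ.filter fun τ : ↥B ⊕ ↥Ys => cube τ = i).card ≤ G)
    (hek : 0 < ek) (hek1 : ek ≤ Real.exp (-1)) {θ β' : ℝ} (hθ0 : 0 < θ) (hθ1 : θ ≤ 1) (hβ : 0 ≤ β')
    (hreg : (n₀ : ℝ) + 1 ≤ m / (8 * Λ ^ 2) * (81 / 100) * c₀ ^ 2 * Real.log ek⁻¹ ^ (2 * p - 1))
    (hpre₂ : C ^ n₀ * (4 * Real.exp (F ^ 2 / m)) * Real.exp (2 * G * K₁) * ek ≤ 1)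
    (hvac₂ : Real.exp (2 * G * K₁) * (2 * G) * (4 * Real.exp (F ^ 2 / m)) * ek + (Real.exp (2 * G * K₁) - 1) ≤ θ ^ (2 * β') / 2)
    (hekθ₂ : ek ≤ θ ^ (1 + β') / 2) (hKθ₂ : ∀ Y ∈ Ys, KY Y * Real.exp (2 * G * K₁) ≤ θ ^ (1 + β') / 2)
    (Λc X : Finset I) {t : ℝ} (ht : t ∈ Set.Ioc (0 : ℝ) 1) {L : Type} [Fintype L] [DecidableEq L] (hL : Fintype.card L ≤ n₀)
    (γ : L → ↥(slotB B Ys cube X) ⊕ ↥(slotY B Ys cube X)) (H : Finset L) (X₂ : Finset I) (hX₂ : X₂.card = 2) :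
    |locAct (cubeIn cube X ∘ γ) (actIn blk Δ ℱ adj χ p ek B Φ c Ys V cube Λc X t γ) H X₂| ≤
      θ ^ ((H.card : ℝ) + β' * ((X₂ \ H.image (cubeIn cube X ∘ γ)).card : ℝ)) := by
  obtain ⟨i, j, hij, rfl⟩ := card_eq_two.1 hX₂
  by_cases hloc : ∀ l ∈ H, (cubeIn cube X ∘ γ) l ∈ ({i, j} : Finset I)
  swap
  · rw [locAct_of_not_loc hloc, abs_zero]
    exact Real.rpow_nonneg hθ0.le _
  rw [locAct_of_loc hloc, actIn_pair_eq blk Δ ℱ adj χ p ek B Φ c Ys V cube Λc X t γ H hij]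
  split_ifs with hconn
  swap
  · rw [abs_zero]
    exact Real.rpow_nonneg hθ0.le _
  set Y : Finset I := {i, j} with hY
  have hYc : Y.card = 2 := by rw [hY, card_pair hij]
  -- measurability of the slot fields (linear maps / moduli on a finite-dimensional space)
  have hΦm : ∀ b ∈ B, Measurable (Φ b) := fun b hb => by
    obtain ⟨ℓ₁, ℓ₂, h₁, h₂, h, -, -⟩ := hmod b hb
    exact (BIJ88GaussShellModulus309.continuous_and_zero_of_mod h₁ h₂ h).1.measurable
  -- the two region laws are probability measures
  have hΔc := interp_corner_posDef blk Δ hΔ Λc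
  haveI hP1 : IsProbabilityMeasure (regionLaw blk (interpForm blk Δ (corner ℝ Λc)) ℱ Y Y) :=
    isProbabilityMeasure_regionLaw blk _ ℱ hΔc Y Y
  haveI hP0 : IsProbabilityMeasure (regionLaw blk (interpForm blk Δ (corner ℝ Λc)) ℱ Y ∅) :=
    isProbabilityMeasure_regionLaw blk _ ℱ hΔc Y ∅
  -- the joint slot family of the two cubes
  set T : Finset (↥(slotB B Ys cube X) ⊕ ↥(slotY B Ys cube X)) := univ.filter (fun τ => cubeIn cube X τ ∈ Y) with hT
  have hcb' : ∀ b ∈ T.toLeft, c₀ ≤ (fun b : ↥B => c b) b.1 := fun b _ => hcb b.1 b.1.2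
  have hK' : ∀ Y' ∈ T.toRight, ∀ ω : {x : α // blk x ∈ Y} → ℝ,
      |(fun (Y' : ↥Ys) ω => V Y' (ext blk Y ω)) Y'.1 ω| ≤ (fun Y' : ↥Ys => KY Y') Y'.1 := fun Y' _ ω => hK Y'.1 Y'.1.2 _
  have hKY0 : ∀ Y' ∈ T.toRight, 0 ≤ (fun Y' : ↥Ys => KY Y') Y'.1 := fun Y' _ => (abs_nonneg _).trans (hK Y'.1 Y'.1.2 0)
  have hΦ' : ∀ b ∈ T.toLeft, Measurable fun ω : {x : α // blk x ∈ Y} → ℝ =>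
      (fun (b : ↥B) ω => Φ b (ext blk Y ω)) b.1 ω := fun b _ => (hΦm b.1 b.1.2).comp (measurable_ext blk Y)
  have hV' : ∀ Y' ∈ T.toRight, Measurable fun ω : {x : α // blk x ∈ Y} → ℝ =>
      (fun (Y' : ↥Ys) ω => V Y' (ext blk Y ω)) Y'.1 ω := fun Y' _ => (hV Y'.1 Y'.1.2).comp (measurable_ext blk Y)
  -- at most `2G` slots on the pair; interaction weight `Σ K_Y ≤ 2G K₁`
  have hTG : T.card ≤ 2 * G := by
    have hsub : T ⊆ univ.filter (fun τ => cubeIn cube X τ = i) ∪ univ.filter (fun τ => cubeIn cube X τ = j) := by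
      intro τ hτ
      have hτ' := (mem_filter.1 hτ).2
      rw [hY, mem_insert, mem_singleton] at hτ'
      rcases hτ' with h | h
      · exact mem_union_left _ (mem_filter.2 ⟨mem_univ _, h⟩)
      · exact mem_union_right _ (mem_filter.2 ⟨mem_univ _, h⟩)
    calc T.card ≤ (univ.filter (fun τ => cubeIn cube X τ = i) ∪ univ.filter (fun τ => cubeIn cube X τ = j)).card := card_le_card hsub
      _ ≤ (univ.filter (fun τ => cubeIn cube X τ = i)).card + (univ.filter (fun τ => cubeIn cube X τ = j)).card := card_union_le _ _
      _ ≤ G + G := Nat.add_le_add ((card_filter_cubeIn_le (cube := cube) X i).trans (hG i))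
          ((card_filter_cubeIn_le (cube := cube) X j).trans (hG j))
      _ = 2 * G := by ring
  have hKsum : ∑ Y' ∈ T.toRight, (fun Y' : ↥Ys => KY Y') Y'.1 ≤ 2 * G * K₁ := by
    refine (sum_le_card_nsmul _ _ K₁ fun Y' _ => hK₁ Y'.1 Y'.1.2).trans ?_
    rw [nsmul_eq_mul]
    have h : ((T.toRight).card : ℝ) ≤ 2 * G := by exact_mod_cast (Finset.card_toRight_le).trans hTG
    exact mul_le_mul_of_nonneg_right h hK₁0
  have hGl : ((T.toLeft).card : ℝ) ≤ 2 * G := by exact_mod_cast (Finset.card_toLeft_le).trans hTG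
  -- Gaussian tails of the slot fields under BOTH laws, from structural data (`‖ℱ|_{□_i∪□_j}‖₂² ≤ 2F²`)
  have hFY : src blk ℱ Y ⬝ᵥ src blk ℱ Y ≤ (Real.sqrt 2 * F) ^ 2 := src_pair_le blk ℱ hF hij
  have hA2 : (Real.sqrt 2 * F) ^ 2 / (2 * m) = F ^ 2 / m := by
    rw [mul_pow, Real.sq_sqrt (by norm_num : (0 : ℝ) ≤ 2)]
    field_simp
  have htail : ∀ Λ' : Finset I, ∀ b ∈ T.toLeft, ∀ a : ℝ, 0 ≤ a →
      (regionLaw blk (interpForm blk Δ (corner ℝ Λc)) ℱ Y Λ').real {ω | a ≤ |(fun (b : ↥B) ω => Φ b (ext blk Y ω)) b.1 ω|} ≤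
        4 * Real.exp (F ^ 2 / m) * Real.exp (-(m / (8 * Λ ^ 2) * a ^ 2)) := by
    intro Λ' b _ a ha
    obtain ⟨ℓ₁, ℓ₂, h₁, h₂, h, hΛ₁, hΛ₂⟩ := hmod b.1 b.1.2
    rw [← hA2]
    exact tail_slotField_regionLaw_of_struct blk Δ ℱ hΔ hm hΔm h₁ h₂ h hΛ hΛ₁ hΛ₂ (by positivity) Y hFY Λc Λ' ha
  by_cases hH0 : H = ∅
  · -- THE VACUUM PAIR `(∅, {i,j})`: twice the p. 307 vacuum mechanism on the `≤ 2G` slots of the pair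
    subst hH0
    have hreg1 : (1 : ℝ) ≤ m / (8 * Λ ^ 2) * (81 / 100) * c₀ ^ 2 * Real.log ek⁻¹ ^ (2 * p - 1) :=
      le_trans (by have := Nat.cast_nonneg (α := ℝ) n₀; linarith) hreg
    have hvac' : Real.exp (2 * G * K₁) * (2 * G) * (4 * Real.exp (F ^ 2 / m)) * ek + (Real.exp (2 * G * K₁) - 1) ≤
        (θ ^ (2 * β') / 2) ^ (1 : ℝ) := by rw [Real.rpow_one]; exact hvac₂
    rw [show (((∅ : Finset L).card : ℕ) : ℝ) + β' * (((Y \ (∅ : Finset L).image (cubeIn cube X ∘ γ)).card : ℕ) : ℝ) = 2 * β' by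
      rw [card_empty, image_empty, sdiff_empty, hYc]; push_cast; ring]
    simp only [filter_empty, card_empty, iteratedDeriv_zero]
    have h1 := abs_integral_prod_slotFactor_sub_one_le_rpow χ (regionLaw blk (interpForm blk Δ (corner ℝ Λc)) ℱ Y Y) p ek
      (slotB B Ys cube X) (fun b ω => Φ b (ext blk Y ω)) (fun b => c b) (slotY B Ys cube X) (fun Y' ω => V Y' (ext blk Y ω)) hχ hp hek
      hek1 ht.1 ht.2 T hc₀ hcb' (fun Y' => KY Y') hK' hKsum hΦ' hV' (by positivity) (by positivity) (htail Y) hGl hreg1 hvac'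
    have h0 := abs_integral_prod_slotFactor_sub_one_le_rpow χ (regionLaw blk (interpForm blk Δ (corner ℝ Λc)) ℱ Y ∅) p ek
      (slotB B Ys cube X) (fun b ω => Φ b (ext blk Y ω)) (fun b => c b) (slotY B Ys cube X) (fun Y' ω => V Y' (ext blk Y ω)) hχ hp hek
      hek1 ht.1 ht.2 T hc₀ hcb' (fun Y' => KY Y') hK' hKsum hΦ' hV' (by positivity) (by positivity) (htail ∅) hGl hreg1 hvac'
    rw [Real.rpow_one] at h1 h0
    refine (abs_sub_le _ 1 _).trans ?_
    rw [abs_sub_comm (1 : ℝ)]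
    refine (add_le_add h1 h0).trans (le_of_eq ?_)
    ring
  · -- DERIVATIVES LOCATED IN THE PAIR: twice the p. 309 derivative factors on the joint slot family
    have hne : H.Nonempty := nonempty_iff_ne_empty.2 hH0
    have hH : ∀ l ∈ H, cubeIn cube X (γ l) ∈ Y := hloc
    have hsumT : ∑ τ ∈ univ.filter (fun τ => cubeIn cube X τ ∈ Y), (H.filter fun l => γ l = τ).card = H.card :=
      (card_eq_sum_card_fiberwise (f := γ) fun l hl => mem_filter.2 ⟨mem_univ _, hH l hl⟩).symm
    rw [← hT] at hsumT
    have hk : (Y \ H.image (cubeIn cube X ∘ γ)).card ≤ H.card := by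
      obtain ⟨l, hl⟩ := hne
      have hlt : (Y \ H.image (cubeIn cube X ∘ γ)).card < Y.card := by
        refine card_lt_card ⟨sdiff_subset, fun hsub => ?_⟩
        have hmem := hsub (hH l hl)
        rw [mem_sdiff] at hmem
        exact hmem.2 (mem_image_of_mem _ hl)
      have h1 : 1 ≤ H.card := card_pos.2 ⟨l, hl⟩
      omega
    have hm_le : ∑ τ ∈ T, (H.filter fun l => γ l = τ).card ≤ n₀ := by rw [hsumT]; exact (card_le_univ H).trans hL
    have hm1 : 1 ≤ ∑ τ ∈ T, (H.filter fun l => γ l = τ).card := by rw [hsumT]; exact hne.card_pos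
    have hKθ' : ∀ Y' ∈ T.toRight, (fun Y' : ↥Ys => KY Y') Y'.1 * Real.exp (2 * G * K₁) ≤ θ ^ (1 + β') / 2 :=
      fun Y' _ => hKθ₂ Y'.1 Y'.1.2
    have h1 := abs_integral_prod_iteratedDeriv_slotFactor_le_pow χ (regionLaw blk (interpForm blk Δ (corner ℝ Λc)) ℱ Y Y) p ek
      (slotB B Ys cube X) (fun b ω => Φ b (ext blk Y ω)) (fun b => c b) (slotY B Ys cube X) (fun Y' ω => V Y' (ext blk Y ω)) hC1 hC hp
      hek hek1 ht.1 ht.2 T (fun τ => (H.filter fun l => γ l = τ).card) hm_le hm1 hc₀ hcb' (fun Y' => KY Y') hK' hKY0 hKsum hΦ'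
      (by positivity) (by positivity) (htail Y) hekθ₂ hreg hpre₂ hKθ'
    have h0 := abs_integral_prod_iteratedDeriv_slotFactor_le_pow χ (regionLaw blk (interpForm blk Δ (corner ℝ Λc)) ℱ Y ∅) p ek
      (slotB B Ys cube X) (fun b ω => Φ b (ext blk Y ω)) (fun b => c b) (slotY B Ys cube X) (fun Y' ω => V Y' (ext blk Y ω)) hC1 hC hp
      hek hek1 ht.1 ht.2 T (fun τ => (H.filter fun l => γ l = τ).card) hm_le hm1 hc₀ hcb' (fun Y' => KY Y') hK' hKY0 hKsum hΦ'
      (by positivity) (by positivity) (htail ∅) hekθ₂ hreg hpre₂ hKθ'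
    rw [hsumT] at h1 h0
    refine (abs_sub _ _).trans ?_
    refine (add_le_add h1 h0).trans ?_
    rw [← two_mul]
    exact two_mul_half_rpow_pow_le hθ0 hθ1 hβ hne.card_pos hk

/-! ## §4 The multi-cube part of the located leaf reduced to `|X_β| ≥ 3` -/

/-- **`h5144two` FROM ITS PART ON THE POLYMERS WITH AT LEAST THREE CUBES**: in the two-cube regime of `ineq5144_locAct_pair_of_struct`, the
multi-cube leaf hypothesis of the C2.Eq5.14.5 head of record `BIJ88Eq5145HeadMultiCube.eq5145_zG_mod_W6v_of_ineq5144_two_le` (*(5.14.4), located, on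
the polymers with `≥ 2` cubes*, for the data of a region at `(Λ, t, γ)`) follows from the same statement on the polymers with `≥ 3` cubes — what
remains of (5.14.4) in this lineage is the inductive cluster-expansion decay on `|X_β| ≥ 3` (p. 309: *"The proof of this estimate is similar to the
one for g₂"*). [cite: BalabanImbrieJaffe1988, (5.14.4) p.309; (5.14.5) p.312] -/
theorem two_le_of_three_le [Fintype ι] [Fintype υ] (hp : 1 / 2 < p) {n₀ : ℕ} {C : ℝ} (hC1 : 1 ≤ C)
    (hC : ∀ i, i ≤ n₀ → ∀ (A : ℝ) ⦃q e t : ℝ⦄, q ≠ 0 → 0 < e → 0 < t → t * e ≤ Real.exp (-1) →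
      |iteratedDeriv i (fun s => cutoff χ (q * pLog p (s * e)) A) t| ≤ C * t ^ (-(i : ℤ)))
    (hΔ : Δ.PosDef) {m : ℝ} (hm : 0 < m) (hΔm : ∀ φ : α → ℝ, m * (φ ⬝ᵥ φ) ≤ φ ⬝ᵥ (Δ *ᵥ φ))
    (hχ : ∀ x, 0 ≤ χ.χ₁ x) {c₀ : ℝ} (hc₀ : 0 < c₀) (hcb : ∀ b ∈ B, c₀ ≤ c b) {Λ : ℝ} (hΛ : 0 < Λ)
    (hmod : ∀ b ∈ B, ∃ ℓ₁ ℓ₂ : (α → ℝ) → ℝ, IsLinearMap ℝ ℓ₁ ∧ IsLinearMap ℝ ℓ₂ ∧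
      ((∀ φ, Φ b φ = ℓ₁ φ) ∨ (∀ φ, Φ b φ = Real.sqrt (ℓ₁ φ ^ 2 + ℓ₂ φ ^ 2))) ∧
      (∀ φ, |ℓ₁ φ| ≤ Λ * Real.sqrt (φ ⬝ᵥ φ)) ∧ (∀ φ, |ℓ₂ φ| ≤ Λ * Real.sqrt (φ ⬝ᵥ φ)))
    {F : ℝ} (hF0 : 0 ≤ F) (hF : ∀ i : I, src blk ℱ {i} ⬝ᵥ src blk ℱ {i} ≤ F ^ 2)
    (hV : ∀ Y ∈ Ys, Measurable (V Y)) {KY : υ → ℝ} (hK : ∀ Y ∈ Ys, ∀ φ, |V Y φ| ≤ KY Y)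
    {K₁ : ℝ} (hK₁0 : 0 ≤ K₁) (hK₁ : ∀ Y ∈ Ys, KY Y ≤ K₁) {G : ℕ} (hG : ∀ i, (univ.filter fun τ : ↥B ⊕ ↥Ys => cube τ = i).card ≤ G)
    (hek : 0 < ek) (hek1 : ek ≤ Real.exp (-1)) {θ β' : ℝ} (hθ0 : 0 < θ) (hθ1 : θ ≤ 1) (hβ : 0 ≤ β')
    (hreg : (n₀ : ℝ) + 1 ≤ m / (8 * Λ ^ 2) * (81 / 100) * c₀ ^ 2 * Real.log ek⁻¹ ^ (2 * p - 1))
    (hpre₂ : C ^ n₀ * (4 * Real.exp (F ^ 2 / m)) * Real.exp (2 * G * K₁) * ek ≤ 1)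
    (hvac₂ : Real.exp (2 * G * K₁) * (2 * G) * (4 * Real.exp (F ^ 2 / m)) * ek + (Real.exp (2 * G * K₁) - 1) ≤ θ ^ (2 * β') / 2)
    (hekθ₂ : ek ≤ θ ^ (1 + β') / 2) (hKθ₂ : ∀ Y ∈ Ys, KY Y * Real.exp (2 * G * K₁) ≤ θ ^ (1 + β') / 2)
    (Λc X : Finset I) {t : ℝ} (ht : t ∈ Set.Ioc (0 : ℝ) 1) {L : Type} [Fintype L] [DecidableEq L] (hL : Fintype.card L ≤ n₀)
    (γ : L → ↥(slotB B Ys cube X) ⊕ ↥(slotY B Ys cube X))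
    (h3 : ∀ (H : Finset L) (X₃ : Finset I), 3 ≤ X₃.card →
      |locAct (cubeIn cube X ∘ γ) (actIn blk Δ ℱ adj χ p ek B Φ c Ys V cube Λc X t γ) H X₃| ≤
        θ ^ ((H.card : ℝ) + β' * ((X₃ \ H.image (cubeIn cube X ∘ γ)).card : ℝ)))
    (H : Finset L) (X'' : Finset I) (h2 : 2 ≤ X''.card) :
    |locAct (cubeIn cube X ∘ γ) (actIn blk Δ ℱ adj χ p ek B Φ c Ys V cube Λc X t γ) H X''| ≤
      θ ^ ((H.card : ℝ) + β' * ((X'' \ H.image (cubeIn cube X ∘ γ)).card : ℝ)) := by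
  by_cases h : X''.card = 2
  · exact ineq5144_locAct_pair_of_struct blk Δ ℱ adj χ cube hp hC1 hC hΔ hm hΔm hχ hc₀ hcb hΛ hmod hF0 hF hV hK hK₁0 hK₁ hG hek hek1
      hθ0 hθ1 hβ hreg hpre₂ hvac₂ hekθ₂ hKθ₂ Λc X ht hL γ H X'' h
  · exact h3 H X'' (by omega)

end TwoCube

end Literature.MathematicalPhysics.QuantumFieldTheory.BalabanImbrieJaffe1984to88.BIJ88Ineq5144TwoCube

end
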